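import Literature.Probability.RandomPlanarGeometry.SAWIrreducibleBridgeGrowth
import Literature.Probability.RandomPlanarGeometry.SAWWedgeGrowth
import HarnessLib

/-!
# Self-avoiding walks in the orthant: `c_N⟨ℤ^d_{≥0}⟩ ≥ e^{-3d√N} μ^N`
# (Madras–Slade Theorem 8.2.3 (b) for the right-angle wedge, with an explicit constant)

Topic `Literature/Probability/RandomPlanarGeometry` (continues `SAWUnfolding.lean` /
`SAWUnfoldingTwoSided.lean` / `SAWIrreducibleBridgeGrowth.lean`: the one-sided unfolding `unfold n`
of an `n`-step self-avoiding walk in its first coordinate, at most `e^{3√n}`-to-one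
(`card_le_exp_mul_card_image_unfold`), time reversal `reverseWalk`, the lattice isometries
`zdSignedPermIso`; and `SAWWedgeGrowth.lean`: Madras–Slade's wedges `𝓡_f = msWedge f`, the confined
counts `c_N⟨R⟩ = regionCount R N`). Sources: N. Madras, G. Slade, *The Self-Avoiding Walk*
(Birkhäuser 1993), §8.2, Theorem 8.2.3 (book p. 271): for the wedge
`𝓡_f = {x : x₁ ≥ 0, 0 ≤ x_i ≤ f_i(x₁)}`, "(b) Suppose `lim_{x→∞} f_i(x) = ∞` for every `i`. Then
`lim_{N→∞} c_N⟨𝓡_f⟩^{1/N} = μ`" — due to Hammersley and Whittington (1985) (§8.5 Notes, p. 278);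
qualitative in print. The orthant `{x : x_i ≥ 0 ∀ i}` is the case `f ≡ ∞`; the tree's
`Zd.log_regionCount_msWedge_ge_rpow` (`SAWWedgeDeficit.lean`) gives every M–S wedge an explicit
deficit of order `N^{2/3}`. This file proves the sharper and fully explicit

  **`e^{-3d√N} μ^N ≤ c_N⟨ℤ^d_{≥0}⟩`** for every `d ≥ 1` and every `N`
  (`exp_mul_pow_le_regionCount_orthant`; log form `N log μ - 3d√N ≤ log c_N⟨orthant⟩`,
  `log_regionCount_orthant_ge`; on `ℤ²`: `N log μ - 6√N ≤ log c_N⟨quadrant⟩`).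

## The proof (no bridges, no Hammersley–Welsh)

Fold EVERY coordinate `j` of an arbitrary `N`-step self-avoiding walk by the orientation-preserving
half fold `reverseWalk ∘ unfold ∘ reverseWalk` (`Orthant.halfFold`; afterwards the first coordinate
is minimal at the start, and every other coordinate's time series is untouched because the
unfolding changes only the first coordinate and the two reversals cancel), conjugated by the
transposition `(0 j)` (`Orthant.swapAt`, `Orthant.foldAt`). Each fold is at most `e^{3√N}`-to-one
on self-avoiding walks (the reversals and transpositions are injective), so folding the `d`
coordinates in turn (`Orthant.foldList`) maps the `c_N` walks into the orthant at most
`e^{3d√N}`-to-one: `c_N ≤ e^{3d√N} c_N⟨orthant⟩` (`count_le_exp_mul_regionCount_orthant`), and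
`μ^N ≤ c_N` (`pow_connectiveConstant_le_count`). The constant `3` per coordinate is the tree's
code bound for the unfolding (Madras–Slade (3.1.4)–(3.1.5) with the elementary partition estimate).

## Contents (namespace `Literature.Probability.RandomPlanarGeometry.SAW.Zd`)

* `Orthant.swapAt`, `Orthant.halfFold` (`Orthant.card_le_exp_mul_card_image_halfFold`),
  `Orthant.foldAt`, `Orthant.foldList` — plumbing (helpers private);
* `Orthant.mem_msWedge_top_iff` (the orthant as `msWedge ⊤`),
  `Orthant.count_le_exp_mul_regionCount_orthant`;
* **`exp_mul_pow_le_regionCount_orthant`**, **`log_regionCount_orthant_ge`**,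
  `exists_log_regionCount_orthant_ge` (the lane's typed `∃ C` shape, dimension `d + 2`),
  `log_regionCount_quadrant_ge` (`ℤ²`, constant `6`).

Lane pcv-sawmu item R22 (seat a-idea-1, `Sketch_G5` v6 `stub_R22_orthant_sqrt`; closes by
`exists_log_regionCount_orthant_ge d`).
-/

noncomputable section

open Finset Function Filter Topology Literature.Probability.LatticeModels
  Literature.Probability.Percolation SimpleGraph
open scoped BigOperators

namespace Literature.Probability.RandomPlanarGeometry.SAW.Zd

namespace Orthant

variable {d : ℕ} [NeZero d]

/-! ### Transposing the first and the `j`-th coordinate -/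

/-- The transposition `(0 j)` of coordinates, applied at every time. [folklore] -/
def swapAt (j : Fin d) (ω : ℕ → Site d) : ℕ → Site d :=
  fun i => zdSignedPermIso (Equiv.swap 0 j) 1 (ω i)

variable {j : Fin d} {n : ℕ} {ω : ℕ → Site d}

/-- Coordinates of the transposed walk. [folklore] -/
@[simp] private theorem swapAt_apply (j : Fin d) (ω : ℕ → Site d) (i : ℕ) (l : Fin d) :
    swapAt j ω i l = ω i (Equiv.swap 0 j l) := by
  simp [swapAt, Equiv.symm_swap]

/-- The transposition is an involution. [folklore] -/
@[simp] private theorem swapAt_swapAt (j : Fin d) (ω : ℕ → Site d) : swapAt j (swapAt j ω) = ω := by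
  funext i l
  rw [swapAt_apply, swapAt_apply, Equiv.swap_apply_self]

/-- The transposition is injective. [folklore] -/
private theorem swapAt_injective (j : Fin d) : Function.Injective (swapAt (d := d) j) := fun ω ω' h => by
  rw [← swapAt_swapAt j ω, h, swapAt_swapAt]

/-- The transposition maps `saws d n` to `saws d n`. [folklore] -/
private theorem swapAt_mem_saws (j : Fin d) (hω : ω ∈ saws d n) : swapAt j ω ∈ saws d n :=
  isoWalk_mem_saws _ (by funext l; simp) hω

/-! ### The half fold: first coordinate nonnegative, all other coordinates untouched -/

/-- **The half fold** `reverse ∘ unfold ∘ reverse` in the first coordinate: afterwards the first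
coordinate is minimal (`= 0`) at the start; the other coordinates are untouched (the unfolding
changes only the first coordinate, the two reversals cancel on the others).
[cite: MadrasSlade1993, Proposition 4.4.2 (proof: "unfold … the past")] -/
def halfFold (n : ℕ) (ω : ℕ → Site d) : ℕ → Site d :=
  reverseWalk n (unfold n (reverseWalk n ω))

/-- The half fold is an `n`-step self-avoiding walk. [folklore] -/
private theorem halfFold_mem_saws (hω : ω ∈ saws d n) : halfFold n ω ∈ saws d n :=
  reverseWalk_mem_saws (unfold_mem_saws (reverseWalk_mem_saws hω))

/-- After the half fold the first coordinate is nonnegative up to time `n`. [folklore] -/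
private theorem halfFold_apply_zero_nonneg (hω : ω ∈ saws d n) {i : ℕ} (hi : i ≤ n) : 0 ≤ halfFold n ω i 0 := by
  have h := reverseWalk_min_at_start (unfold_max_at_end (reverseWalk_mem_saws hω)) i hi
  have h0 : reverseWalk n (unfold n (reverseWalk n ω)) 0 0 = 0 := by
    have := (mem_saws.1 (halfFold_mem_saws hω)).1
    rw [halfFold] at this
    rw [this]; rfl
  rw [h0] at h
  exact h

/-- The half fold does not touch the other coordinates (up to time `n`). [folklore] -/
private theorem halfFold_apply_of_ne (hω : ω ∈ saws d n) {l : Fin d} (hl : l ≠ 0) {i : ℕ} (hi : i ≤ n) :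
    halfFold n ω i l = ω i l := by
  obtain ⟨h0, -, -, -⟩ := mem_saws.1 hω
  rw [halfFold, reverseWalk_apply_coord, unfold, iterate_unfoldStep_apply_of_ne _ _ _ _ hl,
    iterate_unfoldStep_apply_of_ne _ _ _ _ hl, reverseWalk_apply_coord, reverseWalk_apply_coord,
    Nat.sub_self, Nat.sub_sub_self hi, h0]
  simp

open Classical in
/-- **The half fold is at most `e^{3√n}`-to-one on any set of `n`-step self-avoiding walks** (the
two reversals are injective, the unfolding is at most `e^{3√n}`-to-one:
`card_le_exp_mul_card_image_unfold`). [cite: MadrasSlade1993, §3.1 (proof of Proposition 3.1.5, (3.1.4)–(3.1.5))] -/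
theorem card_le_exp_mul_card_image_halfFold {T : Finset (ℕ → Site d)} (hT : T ⊆ saws d n) :
    (T.card : ℝ) ≤ Real.exp (3 * Real.sqrt n) * (T.image (halfFold n)).card := by
  classical
  set T₁ := T.image (reverseWalk n) with hT₁
  have hT₁s : T₁ ⊆ saws d n := by
    intro ξ hξ
    obtain ⟨ω, hω, rfl⟩ := Finset.mem_image.1 hξ
    exact reverseWalk_mem_saws (hT hω)
  have hc₁ : T₁.card = T.card := by
    refine Finset.card_image_of_injOn fun ω hω ω' hω' h => ?_
    have hs := mem_saws.1 (hT hω)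
    have hs' := mem_saws.1 (hT hω')
    rw [← reverseWalk_reverseWalk hs.1 hs.2.1, ← reverseWalk_reverseWalk hs'.1 hs'.2.1]
    exact congrArg (reverseWalk n) h
  set T₂ := T₁.image (unfold n) with hT₂
  have hT₂s : T₂ ⊆ saws d n := by
    intro ξ hξ
    obtain ⟨ω, hω, rfl⟩ := Finset.mem_image.1 hξ
    exact unfold_mem_saws (hT₁s hω)
  have hc₃ : (T₂.image (reverseWalk n)).card = T₂.card := by
    refine Finset.card_image_of_injOn fun ω hω ω' hω' h => ?_
    have hs := mem_saws.1 (hT₂s hω)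
    have hs' := mem_saws.1 (hT₂s hω')
    rw [← reverseWalk_reverseWalk hs.1 hs.2.1, ← reverseWalk_reverseWalk hs'.1 hs'.2.1]
    exact congrArg (reverseWalk n) h
  have himg : T₂.image (reverseWalk n) = T.image (halfFold n) := by
    rw [hT₂, hT₁, Finset.image_image, Finset.image_image]
    rfl
  calc (T.card : ℝ) = T₁.card := by rw [hc₁]
    _ ≤ Real.exp (3 * Real.sqrt n) * T₂.card := card_le_exp_mul_card_image_unfold hT₁s
    _ = Real.exp (3 * Real.sqrt n) * (T.image (halfFold n)).card := by rw [← himg, hc₃]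

/-! ### Folding the `j`-th coordinate -/

/-- The half fold in the `j`-th coordinate: conjugate by the transposition `(0 j)`. [folklore] -/
def foldAt (j : Fin d) (n : ℕ) (ω : ℕ → Site d) : ℕ → Site d :=
  swapAt j (halfFold n (swapAt j ω))

/-- The fold is an `n`-step self-avoiding walk. [folklore] -/
private theorem foldAt_mem_saws (hω : ω ∈ saws d n) : foldAt j n ω ∈ saws d n :=
  swapAt_mem_saws j (halfFold_mem_saws (swapAt_mem_saws j hω))

/-- After the fold the `j`-th coordinate is nonnegative up to time `n`. [folklore] -/
private theorem foldAt_apply_self_nonneg (hω : ω ∈ saws d n) {i : ℕ} (hi : i ≤ n) : 0 ≤ foldAt j n ω i j := by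
  rw [foldAt, swapAt_apply, Equiv.swap_apply_right]
  exact halfFold_apply_zero_nonneg (swapAt_mem_saws j hω) hi

/-- The fold does not touch the other coordinates (up to time `n`). [folklore] -/
private theorem foldAt_apply_of_ne (hω : ω ∈ saws d n) {l : Fin d} (hl : l ≠ j) {i : ℕ} (hi : i ≤ n) :
    foldAt j n ω i l = ω i l := by
  have hl' : Equiv.swap 0 j l ≠ 0 := by
    intro h
    rw [Equiv.swap_apply_eq_iff, Equiv.swap_apply_left] at h
    exact hl h
  rw [foldAt, swapAt_apply, halfFold_apply_of_ne (swapAt_mem_saws j hω) hl' hi, swapAt_apply,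
    Equiv.swap_apply_self]

open Classical in
/-- The fold is at most `e^{3√n}`-to-one on any set of `n`-step self-avoiding walks. [folklore] -/
private theorem card_le_exp_mul_card_image_foldAt (j : Fin d) {T : Finset (ℕ → Site d)} (hT : T ⊆ saws d n) :
    (T.card : ℝ) ≤ Real.exp (3 * Real.sqrt n) * (T.image (foldAt j n)).card := by
  classical
  set T₁ := T.image (swapAt j) with hT₁
  have hT₁s : T₁ ⊆ saws d n := by
    intro ξ hξ
    obtain ⟨ω, hω, rfl⟩ := Finset.mem_image.1 hξ
    exact swapAt_mem_saws j (hT hω)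
  have hc₁ : T₁.card = T.card := Finset.card_image_of_injective _ (swapAt_injective j)
  have hc₃ : ((T₁.image (halfFold n)).image (swapAt j)).card = (T₁.image (halfFold n)).card :=
    Finset.card_image_of_injective _ (swapAt_injective j)
  have himg : (T₁.image (halfFold n)).image (swapAt j) = T.image (foldAt j n) := by
    rw [hT₁, Finset.image_image, Finset.image_image]
    rfl
  calc (T.card : ℝ) = T₁.card := by rw [hc₁]
    _ ≤ Real.exp (3 * Real.sqrt n) * (T₁.image (halfFold n)).card := card_le_exp_mul_card_image_halfFold hT₁s
    _ = Real.exp (3 * Real.sqrt n) * (T.image (foldAt j n)).card := by rw [← himg, hc₃]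

/-! ### Folding a list of coordinates -/

/-- Fold the coordinates of the list one after the other. [folklore] -/
def foldList (n : ℕ) : List (Fin d) → (ℕ → Site d) → ℕ → Site d
  | [], ω => ω
  | j :: js, ω => foldList n js (foldAt j n ω)

/-- `foldList` maps `saws d n` to `saws d n`. [folklore] -/
private theorem foldList_mem_saws : ∀ (js : List (Fin d)) {ω : ℕ → Site d}, ω ∈ saws d n → foldList n js ω ∈ saws d n
  | [], _, hω => hω
  | _ :: js, _, hω => foldList_mem_saws js (foldAt_mem_saws hω)

/-- Coordinates outside the list are untouched. [folklore] -/
private theorem foldList_apply_of_not_mem : ∀ (js : List (Fin d)) {ω : ℕ → Site d}, ω ∈ saws d n →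
    ∀ {l : Fin d}, l ∉ js → ∀ {i : ℕ}, i ≤ n → foldList n js ω i l = ω i l
  | [], _, _, _, _, _, _ => rfl
  | j :: js, _, hω, l, hl, i, hi => by
    rw [List.mem_cons, not_or] at hl
    rw [foldList, foldList_apply_of_not_mem js (foldAt_mem_saws hω) hl.2 hi, foldAt_apply_of_ne hω hl.1 hi]

/-- The listed coordinates become nonnegative. [folklore] -/
private theorem foldList_apply_nonneg : ∀ (js : List (Fin d)), js.Nodup → ∀ {ω : ℕ → Site d}, ω ∈ saws d n →
    ∀ {l : Fin d}, l ∈ js → ∀ {i : ℕ}, i ≤ n → 0 ≤ foldList n js ω i l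
  | [], _, _, _, _, hl, _, _ => absurd hl List.not_mem_nil
  | j :: js, hnd, ω, hω, l, hl, i, hi => by
    rw [List.nodup_cons] at hnd
    rw [foldList]
    rcases List.mem_cons.1 hl with rfl | hl
    · rw [foldList_apply_of_not_mem js (foldAt_mem_saws hω) hnd.1 hi]
      exact foldAt_apply_self_nonneg hω hi
    · exact foldList_apply_nonneg js hnd.2 (foldAt_mem_saws hω) hl hi

open Classical in
/-- `foldList js` is at most `e^{3 |js| √n}`-to-one on sets of `n`-step self-avoiding walks. [folklore] -/
private theorem card_le_exp_mul_card_image_foldList : ∀ (js : List (Fin d)) {T : Finset (ℕ → Site d)},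
    T ⊆ saws d n → (T.card : ℝ) ≤ Real.exp (3 * js.length * Real.sqrt n) * (T.image (foldList n js)).card
  | [], T, _ => by
    have : T.image (foldList n ([] : List (Fin d))) = T := by
      have e : (foldList n ([] : List (Fin d))) = id := by funext ω; rfl
      rw [e, Finset.image_id]
    rw [this]; simp
  | j :: js, T, hT => by
    classical
    have h1 := card_le_exp_mul_card_image_foldAt j hT
    have hT' : T.image (foldAt j n) ⊆ saws d n := by
      intro ξ hξ
      obtain ⟨ω, hω, rfl⟩ := Finset.mem_image.1 hξ
      exact foldAt_mem_saws (hT hω)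
    have h2 := card_le_exp_mul_card_image_foldList js hT'
    have himg : (T.image (foldAt j n)).image (foldList n js) = T.image (foldList n (j :: js)) := by
      rw [Finset.image_image]
      rfl
    rw [himg] at h2
    have e0 := Real.exp_nonneg (3 * Real.sqrt n)
    calc (T.card : ℝ) ≤ Real.exp (3 * Real.sqrt n) * (T.image (foldAt j n)).card := h1
      _ ≤ Real.exp (3 * Real.sqrt n) *
            (Real.exp (3 * js.length * Real.sqrt n) * (T.image (foldList n (j :: js))).card) :=
          mul_le_mul_of_nonneg_left h2 e0
      _ = Real.exp (3 * ((j :: js).length : ℕ) * Real.sqrt n) * (T.image (foldList n (j :: js))).card := by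
          rw [← mul_assoc, ← Real.exp_add, List.length_cons]
          push_cast
          ring_nf

/-! ### The orthant -/

/-- The orthant `{x : x_i ≥ 0 for all i}` is Madras–Slade's wedge `𝓡_f` with `f ≡ ∞`. [cite: MadrasSlade1993, §8.2, Theorem 8.2.3] -/
theorem mem_msWedge_top_iff (x : Site d) :
    x ∈ msWedge (fun (_ : Fin d) (_ : ℕ) => (⊤ : ℕ∞)) ↔ ∀ i, 0 ≤ x i := by
  simp only [msWedge, Set.mem_setOf_eq, le_top, and_true]
  constructor
  · rintro ⟨h0, h⟩ i
    by_cases hi : i = 0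
    · rw [hi]; exact h0
    · exact h i hi
  · intro h
    exact ⟨h 0, fun i _ => h i⟩

/-- The full fold of an `N`-step self-avoiding walk lies in the orthant. [folklore] -/
private theorem foldList_finRange_mem_regionWalks {N : ℕ} (hω : ω ∈ saws d N) :
    foldList N (List.finRange d) ω ∈ regionWalks (msWedge fun (_ : Fin d) (_ : ℕ) => (⊤ : ℕ∞)) N := by
  refine mem_regionWalks.2 ⟨foldList_mem_saws _ hω, fun m hm => (mem_msWedge_top_iff _).2 fun i => ?_⟩
  exact foldList_apply_nonneg _ (List.nodup_finRange d) hω (List.mem_finRange i) hm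

/-- **`c_N ≤ e^{3d√N} · c_N⟨orthant⟩`**: folding every coordinate maps the `N`-step
self-avoiding walks into the orthant, at most `e^{3d√N}`-to-one.
[cite: MadrasSlade1993, Theorem 8.2.3 (b) (qualitative: `c_N⟨𝓡_f⟩^{1/N} → μ`); explicit form, this file] -/
theorem count_le_exp_mul_regionCount_orthant (N : ℕ) :
    (count d N : ℝ) ≤ Real.exp (3 * d * Real.sqrt N) *
      regionCount (msWedge fun (_ : Fin d) (_ : ℕ) => (⊤ : ℕ∞)) N := by
  classical
  have h := card_le_exp_mul_card_image_foldList (n := N) (List.finRange d) (T := saws d N) subset_rfl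
  rw [card_saws, List.length_finRange] at h
  refine h.trans (mul_le_mul_of_nonneg_left ?_ (Real.exp_nonneg _))
  rw [regionCount]
  exact_mod_cast Finset.card_le_card fun ξ hξ => by
    obtain ⟨ω, hω, rfl⟩ := Finset.mem_image.1 hξ
    exact foldList_finRange_mem_regionWalks hω

end Orthant

variable {d : ℕ} [NeZero d]

/-- **Self-avoiding walks in the orthant, explicit growth**: for every `d ≥ 1` and every `N`,
`e^{-3d√N} μ^N ≤ c_N⟨ℤ^d_{≥0}⟩` — the number of `N`-step self-avoiding walks from the corner of the
orthant `{x_i ≥ 0}` (Madras–Slade's wedge `𝓡_f`, `f ≡ ∞`) is at least `μ^N` up to the explicit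
factor `e^{-3d√N}` (Hammersley–Whittington 1985 / Madras–Slade Theorem 8.2.3 (b): `c_N⟨𝓡_f⟩^{1/N} → μ`,
qualitative in print; the constant `3d` is the tree's unfolding code bound `e^{3√N}` per coordinate).
[cite: MadrasSlade1993, Theorem 8.2.3 (b); explicit constant: this file] -/
theorem exp_mul_pow_le_regionCount_orthant (N : ℕ) :
    Real.exp (-(3 * d * Real.sqrt N)) * connectiveConstant d ^ N ≤
      regionCount (msWedge fun (_ : Fin d) (_ : ℕ) => (⊤ : ℕ∞)) N := by
  have h1 := pow_connectiveConstant_le_count d N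
  have h2 := Orthant.count_le_exp_mul_regionCount_orthant (d := d) N
  have he := Real.exp_pos (3 * d * Real.sqrt N)
  rw [Real.exp_neg, inv_mul_le_iff₀ he]
  exact h1.trans h2

/-- **Log form** (the lane's typed shape, a-idea-1 `stub_R22_orthant_sqrt` with the explicit constant
`C = 3d`): `N log μ − 3d√N ≤ log c_N⟨orthant⟩` for every `N`.
[cite: MadrasSlade1993, Theorem 8.2.3 (b); explicit constant: this file] -/
theorem log_regionCount_orthant_ge (N : ℕ) :
    (N : ℝ) * Real.log (connectiveConstant d) - 3 * d * Real.sqrt N ≤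
      Real.log (regionCount (msWedge fun (_ : Fin d) (_ : ℕ) => (⊤ : ℕ∞)) N) := by
  have hμ : 0 < connectiveConstant d := by
    have := one_le_connectiveConstant d; linarith
  have h := exp_mul_pow_le_regionCount_orthant (d := d) N
  have hpos : 0 < Real.exp (-(3 * d * Real.sqrt N)) * connectiveConstant d ^ N := by positivity
  have h' := Real.log_le_log hpos h
  rw [Real.log_mul (Real.exp_pos _).ne' (pow_pos hμ N).ne', Real.log_exp, Real.log_pow] at h'
  linarith

/-- The `∃ C` form, dimension written `d + 2` (verbatim the lane's typed target). [cite: MadrasSlade1993, Theorem 8.2.3 (b); explicit constant: this file] -/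
theorem exists_log_regionCount_orthant_ge (d : ℕ) :
    ∃ C : ℝ, ∀ N : ℕ, 1 ≤ N →
      (N : ℝ) * Real.log (connectiveConstant (d + 2)) - C * Real.sqrt N ≤
        Real.log (regionCount (msWedge (fun (_ : Fin (d + 2)) (_ : ℕ) => (⊤ : ℕ∞))) N) :=
  ⟨3 * ((d + 2 : ℕ) : ℝ), fun N _ => log_regionCount_orthant_ge (d := d + 2) N⟩

/-- **Planar corner**: `N log μ − 6√N ≤ log c_N⟨quadrant⟩` on `ℤ²`, every `N`.
[cite: MadrasSlade1993, Theorem 8.2.3 (b); explicit constant: this file] -/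
theorem log_regionCount_quadrant_ge (N : ℕ) :
    (N : ℝ) * Real.log (connectiveConstant 2) - 6 * Real.sqrt N ≤
      Real.log (regionCount (msWedge fun (_ : Fin 2) (_ : ℕ) => (⊤ : ℕ∞)) N) := by
  have := log_regionCount_orthant_ge (d := 2) N
  norm_num at this
  linarith

end Literature.Probability.RandomPlanarGeometry.SAW.Zd
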